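import Summits.NavierStokesRegularity.NavierStokesRegularity.Theses.SelfMixingDichotomy
import Literature.Analysis.FluidPDE.PassiveScalarEnergyDecay

/-!
# Route SelfMixingDichotomy — crux `CoherentScaleExclusion` (S2, item stmt-NavierStokesRegularity-1423):
# the regime `δ ≥ 1` is empty

By the energy inequality for passive scalars in the velocity field of a classical Leray–Hopf
solution (`IsClassicalNSSolutionOn.dissipatesAtScale_of_isLerayHopfOn`, i.e.
`MIX(u, T, x₀, r, δ) = DissipatesAtScale u T x₀ r δ` holds for every `δ` with `1 ≤ δ²` and every
scale with `r² ≤ T`), NON-`δ`-mixing scales cannot occur below `√T` when `δ ≥ 1`. Hence the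
recurrence hypothesis of the crux S2 is unsatisfiable for `δ ≥ 1` and S2 restricted to `δ ≥ 1`
holds outright (with any threshold, here `M := 0`); the same goes for the three regime stubs of
the birth line `Cruxes/CoherentScaleExclusion/Lines/birth.lean`. The content of S2 is `0 < δ < 1`.

* `coherentScaleExclusion_mix_of_one_le_sq` — `MIX(r, δ)` for `1 ≤ δ²`, `r² ≤ T`.
* `coherentScaleExclusion_not_recur_nonmixing_of_one_le_sq` — for `1 ≤ δ²`, non-`δ`-mixing scales
  do not recur at any final-time point (whatever side condition `P r`, e.g. a load threshold).
* `coherentScaleExclusion_of_one_le` — S2 for `δ ≥ 1` (registered sub-goal of the line lead).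
-/

noncomputable section

namespace Summit.NavierStokesRegularity.NavierStokesRegularity.Theorems

-- single-conjunct summit (`<Problem> = <Summit>`): the duplicated namespace component is by design
set_option linter.dupNamespace false

open MeasureTheory Filter Set Metric
open Literature.Analysis.FluidPDE
open Summit.NavierStokesRegularity.NavierStokesRegularity.Theses.SelfMixingDichotomy

/-- **`MIX(u, T, x₀, r, δ)` for `1 ≤ δ²` and `r² ≤ T`**, for the velocity of a classical solution
on `[0, T)` that is Leray–Hopf on `[0, T]`: the route's inlined scalar dissipation test is
`DissipatesAtScale u T x₀ r δ` (`Iff.rfl`), which holds by the `L²` energy inequality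
(`IsClassicalNSSolutionOn.dissipatesAtScale_of_isLerayHopfOn`). [folklore] -/
theorem coherentScaleExclusion_mix_of_one_le_sq {T r δ : ℝ}
    {u : ℝ → EuclideanSpace ℝ (Fin 3) → EuclideanSpace ℝ (Fin 3)} {p : ℝ → EuclideanSpace ℝ (Fin 3) → ℝ}
    (hcl : IsClassicalNSSolutionOn (Set.Ico 0 T) 1 0 u p) (hLH : IsLerayHopfOn T 1 0 (u 0) u)
    (hrT : r ^ 2 ≤ T) (hδ : 1 ≤ δ ^ 2) (x₀ : EuclideanSpace ℝ (Fin 3)) :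
    (∀ θ : ℝ → EuclideanSpace ℝ (Fin 3) → ℝ, Literature.Analysis.FluidPDE.IsSmoothSpaceTimeOn (Set.Icc (T - r ^ 2) (T - r ^ 2 / 2)) θ → Literature.Analysis.FluidPDE.HasUniformRapidDecayOn (Set.Icc (T - r ^ 2) (T - r ^ 2 / 2)) θ → (∀ t ∈ (Set.Icc (T - r ^ 2) (T - r ^ 2 / 2)), ∀ x : EuclideanSpace ℝ (Fin 3), Literature.Analysis.FluidPDE.timeDerivWithin (Set.Icc (T - r ^ 2) (T - r ^ 2 / 2)) θ t x + inner ℝ (u t x) (gradient (θ t) x) = Laplacian.laplacian (θ t) x) → Function.support (θ (T - r ^ 2)) ⊆ Metric.ball x₀ r → ∫ x, (θ (T - r ^ 2 / 2) x) ^ 2 ≤ δ ^ 2 * ∫ x, (θ (T - r ^ 2) x) ^ 2) :=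
  hcl.dissipatesAtScale_of_isLerayHopfOn hLH hrT hδ x₀

/-- **For `1 ≤ δ²`, non-`δ`-mixing scales do not recur at a final-time point** of a classical
solution on `[0, T)` that is Leray–Hopf on `[0, T]`: below `r₀ = √T` every scale satisfies
`r² ≤ T` and is therefore `δ`-mixing (`coherentScaleExclusion_mix_of_one_le_sq`). The side
condition `P r` (in the crux: the load threshold `ofReal M ≤ cknC r (T, x₀) u`) is arbitrary. [folklore] -/
theorem coherentScaleExclusion_not_recur_nonmixing_of_one_le_sq {T δ : ℝ} (hT : 0 < T)
    {u : ℝ → EuclideanSpace ℝ (Fin 3) → EuclideanSpace ℝ (Fin 3)} {p : ℝ → EuclideanSpace ℝ (Fin 3) → ℝ}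
    (hcl : IsClassicalNSSolutionOn (Set.Ico 0 T) 1 0 u p) (hLH : IsLerayHopfOn T 1 0 (u 0) u)
    (hδ : 1 ≤ δ ^ 2) (x₀ : EuclideanSpace ℝ (Fin 3)) (P : ℝ → Prop) :
    ¬ (∀ r₀ : ℝ, 0 < r₀ → ∃ r ∈ Set.Ioo 0 r₀, P r ∧ ¬ (∀ θ : ℝ → EuclideanSpace ℝ (Fin 3) → ℝ, Literature.Analysis.FluidPDE.IsSmoothSpaceTimeOn (Set.Icc (T - r ^ 2) (T - r ^ 2 / 2)) θ → Literature.Analysis.FluidPDE.HasUniformRapidDecayOn (Set.Icc (T - r ^ 2) (T - r ^ 2 / 2)) θ → (∀ t ∈ (Set.Icc (T - r ^ 2) (T - r ^ 2 / 2)), ∀ x : EuclideanSpace ℝ (Fin 3), Literature.Analysis.FluidPDE.timeDerivWithin (Set.Icc (T - r ^ 2) (T - r ^ 2 / 2)) θ t x + inner ℝ (u t x) (gradient (θ t) x) = Laplacian.laplacian (θ t) x) → Function.support (θ (T - r ^ 2)) ⊆ Metric.ball x₀ r → ∫ x, (θ (T - r ^ 2 / 2) x) ^ 2 ≤ δ ^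 2 * ∫ x, (θ (T - r ^ 2) x) ^ 2)) := by
  intro hrec
  obtain ⟨r, hr, -, hnot⟩ := hrec (Real.sqrt T) (Real.sqrt_pos.2 hT)
  refine hnot (coherentScaleExclusion_mix_of_one_le_sq hcl hLH ?_ hδ x₀)
  have h1 : r ^ 2 < (Real.sqrt T) ^ 2 := by nlinarith [hr.1, hr.2]
  rw [Real.sq_sqrt hT.le] at h1
  exact h1.le

/-- **The crux `CoherentScaleExclusion` restricted to `δ ≥ 1` holds outright** (registered
sub-goal of the birth line; threshold `M := 0`): for `1 ≤ δ` the recurrence of `M`-loaded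
non-`δ`-mixing scales at a final-time point is impossible
(`coherentScaleExclusion_not_recur_nonmixing_of_one_le_sq`), so the implication to boundedness is
vacuous. The content of S2 is the range `0 < δ < 1`. [folklore] -/
theorem coherentScaleExclusion_of_one_le :
    ∀ δ : ℝ, 1 ≤ δ → ∃ M : ℝ, ∀ T : ℝ, 0 < T → ∀ (u : ℝ → EuclideanSpace ℝ (Fin 3) → EuclideanSpace ℝ (Fin 3)) (p : ℝ → EuclideanSpace ℝ (Fin 3) → ℝ), Literature.Analysis.FluidPDE.IsClassicalNSSolutionOn (Set.Ico 0 T) 1 0 u p → Literature.Analysis.FluidPDE.IsLerayHopfOn T 1 0 (u 0) u → Literature.Analysis.FluidPDE.HasRapidSpatialDecay (u 0) → ∀ x₀ : EuclideanSpace ℝ (Fin 3), (∀ r₀ : ℝ, 0 < r₀ → ∃ r ∈ Set.Ioo 0 r₀, ENNReal.ofReal M ≤ Literature.Analysis.FluidPDE.cknC r ((T, x₀) : ℝ × EuclideanSpace ℝ (Fin 3)) u ∧ ¬ (∀ θ : ℝ → EuclideanSpace ℝ (Fin 3) → ℝ, Literature.Analysis.FluidPDE.IsSmoothSpaceTimeOn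 (Set.Icc (T - r ^ 2) (T - r ^ 2 / 2)) θ → Literature.Analysis.FluidPDE.HasUniformRapidDecayOn (Set.Icc (T - r ^ 2) (T - r ^ 2 / 2)) θ → (∀ t ∈ (Set.Icc (T - r ^ 2) (T - r ^ 2 / 2)), ∀ x : EuclideanSpace ℝ (Fin 3), Literature.Analysis.FluidPDE.timeDerivWithin (Set.Icc (T - r ^ 2) (T - r ^ 2 / 2)) θ t x + inner ℝ (u t x) (gradient (θ t) x) = Laplacian.laplacian (θ t) x) → Function.support (θ (T - r ^ 2)) ⊆ Metric.ball x₀ r → ∫ x, (θ (T - r ^ 2 / 2) x) ^ 2 ≤ δ ^ 2 * ∫ x, (θ (T - r ^ 2) x) ^ 2)) → (∃ ρ : ℝ, 0 < ρ ∧ ∃ M : ℝ, ∀ t ∈ Set.Ioo (T - ρ ^ 2) T, ∀ x ∈ Metric.ball x₀ ρ, ‖u t x‖ ≤ M) := by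
  intro δ hδ
  refine ⟨0, fun T hT u p hcl hLH _hdec x₀ hrec => ?_⟩
  have hδ2 : 1 ≤ δ ^ 2 := by nlinarith
  exact (coherentScaleExclusion_not_recur_nonmixing_of_one_le_sq hT hcl hLH hδ2 x₀ _ hrec).elim

end Summit.NavierStokesRegularity.NavierStokesRegularity.Theorems
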